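import Summits.QuantumAdvantage.QuantumAdvantage.Theorems.CubicForrelationNearExactIsExactSixClasses

/-!
# Crux `CubicForrelation.NearExactIsExact` (stmt-QuantumAdvantage-14043) — `n = 6` DECIDED: `θ₆ = 25/32` (and the rows
  `θ₄ = 3/4`, `θ₂ = 1/2`), part 4/4

Certificate seat `b2b-cforr-cert` (gen 10).  HONEST FRAMING: a DECIDABLE VERDICT about the finite slice `n = 6` of the
crux, obtained by a kernel-run (compiled, `native_decide`) certificate whose checker is proved sound in parts 1–3 —
NOT summit progress (the crux asks for ONE `θ < 1` uniform in `n`; the tree knows `θ ≥ 15/16` from `n = 16`).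

THE VERDICT.  For cubic Boolean functions `f, g : 𝔽₂⁶ → 𝔽₂`:
* `isolation_six_2532`: `Φ(f,g) > 25/32 ⇒ Φ(f,g) = 1` (the tree had `Φ ≥ 7/8 ⇒ Φ = 1`, `isolation_six_closed`, and
  `θ₆ ≤ θ₈ = 13/16` by `theta_mono`);
* `forrelation_f6W_g6W`: the pair `g = x₁x₂x₃ ⊕ x₀x₄x₅`, `f = E₂(x₁,x₂,x₃) ⊕ E₂(x₀,x₄,x₅)` (`E₂` = "exactly two of
  three", i.e. `x₁x₂ ⊕ x₁x₃ ⊕ x₂x₃ ⊕ x₁x₂x₃`) has `Φ = 25/32` exactly — it is the direct sum (tensor square) of the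
  3-bit pair `(E₂, AND₃)`, and `Φ` is multiplicative (`forrelation_directSum`); proved here by kernel evaluation of the
  tree's verified fast Walsh transform (`decide`, standard axioms);
* `theta_six_isLeast`: **`θ₆ = 25/32`** (`IsLeast`), and `forrelation_values_six_isGreatest`: `25/32` is the largest
  forrelation value `< 1` of a cubic pair on `6` bits.
The same certificate format decides the smaller rows in passing: `θ₄ = 3/4` (`cl_certify_two`, `theta_four_isLeast`:
on `4` bits every non-bent cubic has capacity `Σ|W| ≤ 48`, witness `Φ(x₀x₁ ⊕ x₂x₃ ⊕ x₀x₁x₂, x₀x₁ ⊕ x₂x₃) = 3/4`) and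
`θ₂ = 1/2` (`theta_two_isLeast`, all `256` pairs by evaluation).  So the small-`n` table reads
`θ₂ = 1/2 < θ₄ = 3/4 < θ₆ = 25/32 < θ₈ = 13/16 < θ₁₀ = 7/8` — EVERY even `n ≤ 10` is now decided
(`theta_small_rows_strictMono`; `25/32` is also the `type-O` record at `n = 8`, DISPROOF §11.5).

THE CERTIFICATE (`cl_certify_three`): `n = 6`, threshold `T = 400 = (25/32)·2⁹`.  As in `SmallCases`, `g` is reduced to
`C_i ⊕ q` over Hou's six `GL(6,2)`-orbit representatives `C_i` of cubic forms and all `2¹⁵` quadratic forms `q`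
(`196 608` signed tables; the BFS over the `2²⁰` cubic masks and its trusted verification are the tree's `bfs`/`verify`).
Per function: `15 488` are bent on codes (`Φ ∈ {1} ∪ [−1, 3/4]`), `115 648` have capacity `Σ|W_g| ≤ 400`, and the
remaining `65 472` — exactly the non-bent cubics with "type-O" cubic part `C₄ = x₀x₄x₅ ⊕ x₁x₂x₃` or `C₅` (all Walsh
values `≡ 4 (mod 8)`; capacities `408, 424, 440`; spectra `|W|`-multisets `{4⁴⁹,12¹²,20²,28}`, `{4⁴⁶,12¹⁵,20³}`,
`{4⁴⁵,12¹⁸,28}`, `{4⁴²,12²¹,20}`) — pass the meet-in-the-middle SYNDROME test of part 2: no set `M` of codes of weight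
`Σ_{x∈M}|W_g(x)| < (Σ|W_g| − 400)/2` (hence `|M| ≤ 4`) has the `RM(2,6)`-syndrome of the sign pattern of `W_g`, so no
cubic `f` agrees with `sgn W_g` off such an `M`, i.e. `Σ_x (−1)^{f(x)}W_g(x) ≤ 400` for every cubic `f`.  Outside-Lean
cross-check (exact recursive soft decoder of `RM(3,6)`, seat folder `work/c/census6.c`): the value `400` is attained for
`18 496` of these tables and all others have maximum `≤ 384`.

AXIOMS: `cl_certify_three`, `cl_certify_two`, `l2sum_all` (hence the `isolation_*`, `theta_*_isLeast` and
`IsGreatest` statements) use `native_decide` (axiom `Lean.ofReduceBool`; the file is `computational`); the witness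
values `forrelation_f6W_g6W`, `forrelation_f4W_g4W`, `forrelation_two_witness` (kernel `decide` on the tree's verified
list FWT) and parts 1–3 have the standard axioms only.

References: S. Aaronson, A. Ambainis, *Forrelation*, SIAM J. Comput. 47 (2018) §1.1.1; C. Carlet, *Boolean Functions
for Cryptography and Coding Theory* (CUP 2021) §2.2.1, §6.1; X.-D. Hou, *GL(m,2) acting on R(r,m)/R(r−1,m)*, Discrete
Math. 149 (1996); F. J. MacWilliams, N. J. A. Sloane, *The Theory of Error-Correcting Codes* (1977) Ch. 13.
-/

set_option linter.dupNamespace false -- D-0017: single-problem summit ⇒ `QuantumAdvantage.QuantumAdvantage` by design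

namespace Summit.QuantumAdvantage.QuantumAdvantage.Theorems.CubicForrelation.NearExactIsExact

open Finset
open Literature.Computability.QuantumComplexity
open Summit.QuantumAdvantage.QuantumAdvantage.Theorems.SignedExactSliceIsLift.StubMoebius (isDegLeFun_xor isDegLeFun_and)
open Summit.QuantumAdvantage.QuantumAdvantage.Theorems.NearExactIsExact.Negative.SmallCases
  (pt sgnZ wal wspec sigTable wal_sigTable reps6 reps4 gens)

/-! ### The certificate at `n = 6`, threshold `400 = (25/32)·2⁹` -/

/-- **The certificate at `n = 6`** (6 representatives × 2¹⁵ quadratic masks, threshold `400`; BFS over 2²⁰ cubic masks). -/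
theorem cl_certify_three : cl_certify 3 400 reps6 (gens 6) [0, 2, 1] = true := by native_decide

/-- **Every cubic pair on `6` bits has `Φ = 1` or `Φ ≤ 25/32`.** [this work] -/
theorem nearExact_top_six : ∀ f g : (Fin 6 → Bool) → Bool, IsDegLeFun 3 f → IsDegLeFun 3 g →
    forrelation f g = 1 ∨ forrelation f g ≤ 25 / 32 := by
  intro f g hf hg
  have h := cl_certify_sound 3 400 (by norm_num) (by norm_num) (by norm_num) reps6 (gens 6) [0, 2, 1] cl_certify_three f g hf hg
  norm_num at h
  exact h

/-- **Isolation at `25/32` on `6` bits**: for cubic `f, g : 𝔽₂⁶ → 𝔽₂`, `Φ(f,g) > 25/32 ⇒ Φ(f,g) = 1`. [this work] -/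
theorem isolation_six_2532 : ∀ f g : (Fin 6 → Bool) → Bool, IsDegLeFun 3 f → IsDegLeFun 3 g →
    25 / 32 < forrelation f g → forrelation f g = 1 := by
  intro f g hf hg hlt
  rcases nearExact_top_six f g hf hg with h | h
  · exact h
  · linarith

/-! ### The witness pair `Φ = 25/32` (kernel evaluation, standard axioms) -/

/-- `g6W = x₁x₂x₃ ⊕ x₀x₄x₅`: a "type-O" cubic on `6` bits (all Walsh values `≡ 4 (mod 8)`; spectrum `36, ±12, ±4`). -/
def g6W (x : Fin 6 → Bool) : Bool := xor (x 1 && x 2 && x 3) (x 0 && x 4 && x 5)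

/-- `f6W = E₂(x₁,x₂,x₃) ⊕ E₂(x₀,x₄,x₅)` with `E₂(a,b,c) = ab ⊕ ac ⊕ bc ⊕ abc` ("exactly two of three"): the sign pattern
of `W_{g6W}`. -/
def f6W (x : Fin 6 → Bool) : Bool :=
  xor (xor (xor (x 1 && x 2) (x 1 && x 3)) (xor (x 2 && x 3) (x 1 && x 2 && x 3)))
    (xor (xor (x 0 && x 4) (x 0 && x 5)) (xor (x 4 && x 5) (x 0 && x 4 && x 5)))

/-- A product of two coordinates is (at most) cubic. [cite: Carlet2020, §2.2.1 Def. 6] -/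
theorem isDegLeFun_and2 (i j : Fin 6) : IsDegLeFun 3 (fun x : Fin 6 → Bool => (x i && x j)) :=
  (isDegLeFun_and (isDegLeFun_apply i (le_refl 1)) (isDegLeFun_apply j (le_refl 1))).mono (by norm_num)

/-- A product of three coordinates is cubic. [cite: Carlet2020, §2.2.1 Def. 6] -/
theorem isDegLeFun_and3 (i j k : Fin 6) : IsDegLeFun 3 (fun x : Fin 6 → Bool => (x i && x j && x k)) :=
  (isDegLeFun_and (isDegLeFun_and (isDegLeFun_apply i (le_refl 1)) (isDegLeFun_apply j (le_refl 1)))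
    (isDegLeFun_apply k (le_refl 1))).mono (by norm_num)

/-- `g6W` is cubic. [cite: Carlet2020, §2.2.1 Def. 6] -/
theorem isDegLeFun_g6W : IsDegLeFun 3 g6W := by
  unfold g6W
  exact isDegLeFun_xor (isDegLeFun_and3 1 2 3) (isDegLeFun_and3 0 4 5)

/-- `f6W` is cubic. [cite: Carlet2020, §2.2.1 Def. 6] -/
theorem isDegLeFun_f6W : IsDegLeFun 3 f6W := by
  unfold f6W
  exact isDegLeFun_xor
    (isDegLeFun_xor (isDegLeFun_xor (isDegLeFun_and2 1 2) (isDegLeFun_and2 1 3))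
      (isDegLeFun_xor (isDegLeFun_and2 2 3) (isDegLeFun_and3 1 2 3)))
    (isDegLeFun_xor (isDegLeFun_xor (isDegLeFun_and2 0 4) (isDegLeFun_and2 0 5))
      (isDegLeFun_xor (isDegLeFun_and2 4 5) (isDegLeFun_and3 0 4 5)))

/-- The kernel evaluation: `Σ_k (−1)^{f6W(pt k)} · (wal (sigTable g6W))_k = 400`. [folklore] -/
theorem val_f6W_g6W :
    ((List.range 64).map fun k => sgnZ (f6W (pt 6 k)) * ((wal 6 (sigTable 6 g6W))[k]?.getD 0)).sum = 400 := by
  decide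

/-- **The witness value**: `Φ(f6W, g6W) = 25/32` (`= 400/512`). [this work] -/
theorem forrelation_f6W_g6W : forrelation f6W g6W = 25 / 32 := by
  have h := ck_forrelation_mul_eq 3 f6W g6W
  have hsum : ∑ k ∈ range (2 ^ (3 + 3)), sgnZ (f6W (pt (3 + 3) k)) * wspec (3 + 3) g6W k = 400 := by
    rw [← val_f6W_g6W, ck_sum_map_range]
    refine sum_congr rfl fun k hk => ?_
    rw [wal_sigTable 6 g6W k (mem_range.1 hk)]
  rw [hsum] at h
  norm_num at h
  linarith

/-! ### `θ₆ = 25/32` -/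

/-- **`θ₆ = 25/32` exactly.** `25/32` is the LEAST `θ` such that every pair of cubic Boolean functions on `6` bits with
`Φ(f,g) > θ` has `Φ(f,g) = 1`: isolation holds at `25/32` (`isolation_six_2532`) and fails at every `θ < 25/32` (the
pair `(f6W, g6W)` has `Φ = 25/32 ≠ 1`).  The `n = 6` slice of the crux `NearExactIsExact`, settled exactly; with
`θ₈ = 13/16` and `θ₁₀ = 7/8` all rows `n ≤ 10` of the ladder are now decided.  NOT summit progress. [this work] -/
theorem theta_six_isLeast :
    IsLeast {θ : ℝ | ∀ f g : (Fin 6 → Bool) → Bool, IsDegLeFun 3 f → IsDegLeFun 3 g →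
      θ < forrelation f g → forrelation f g = 1} (25 / 32) := by
  refine ⟨fun f g hf hg h => isolation_six_2532 f g hf hg h, fun θ hθ => ?_⟩
  by_contra hlt
  have h1 := hθ f6W g6W isDegLeFun_f6W isDegLeFun_g6W (by rw [forrelation_f6W_g6W]; linarith)
  rw [forrelation_f6W_g6W] at h1
  norm_num at h1

/-- **The largest non-exact value at `n = 6` is `25/32`.**  Among all pairs of cubic Boolean functions on `6` bits with
`Φ(f,g) < 1`, the maximum of `Φ` is `25/32`. [this work] -/
theorem forrelation_values_six_isGreatest :
    IsGreatest {φ : ℝ | ∃ f g : (Fin 6 → Bool) → Bool, IsDegLeFun 3 f ∧ IsDegLeFun 3 g ∧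
      forrelation f g = φ ∧ φ < 1} (25 / 32) := by
  refine ⟨⟨f6W, g6W, isDegLeFun_f6W, isDegLeFun_g6W, forrelation_f6W_g6W, by norm_num⟩, ?_⟩
  rintro φ ⟨f, g, hf, hg, rfl, hlt⟩
  by_contra h
  exact absurd (isolation_six_2532 f g hf hg (lt_of_not_ge h)) hlt.ne


/-! ### The same certificate at `n = 4`: `θ₄ = 3/4` -/

/-- **The certificate at `n = 4`** (2 representatives × 2⁶ quadratic masks, threshold `48 = (3/4)·2⁶`: every non-bent cubic on
4 bits has capacity `Σ|W| ≤ 48`, the bent ones have cubic duals). -/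
theorem cl_certify_two : cl_certify 2 48 reps4 (gens 4) [0, 2, 1] = true := by native_decide

/-- **Every cubic pair on `4` bits has `Φ = 1` or `Φ ≤ 3/4`.** [this work] -/
theorem nearExact_top_four : ∀ f g : (Fin 4 → Bool) → Bool, IsDegLeFun 3 f → IsDegLeFun 3 g →
    forrelation f g = 1 ∨ forrelation f g ≤ 3 / 4 := by
  intro f g hf hg
  have h := cl_certify_sound 2 48 (by norm_num) (by norm_num) (by norm_num) reps4 (gens 4) [0, 2, 1] cl_certify_two f g hf hg
  norm_num at h
  exact h

/-- **Isolation at `3/4` on `4` bits**: for cubic `f, g : 𝔽₂⁴ → 𝔽₂`, `Φ(f,g) > 3/4 ⇒ Φ(f,g) = 1`. [this work] -/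
theorem isolation_four_34 : ∀ f g : (Fin 4 → Bool) → Bool, IsDegLeFun 3 f → IsDegLeFun 3 g →
    3 / 4 < forrelation f g → forrelation f g = 1 := by
  intro f g hf hg hlt
  rcases nearExact_top_four f g hf hg with h | h
  · exact h
  · linarith

/-- `g4W = x₀x₁ ⊕ x₂x₃`: the inner-product bent function on `4` bits (self-dual). -/
def g4W (x : Fin 4 → Bool) : Bool := xor (x 0 && x 1) (x 2 && x 3)

/-- `f4W = g4W ⊕ x₀x₁x₂`: the dual of `g4W` perturbed by a cubic monomial of weight `2`. -/
def f4W (x : Fin 4 → Bool) : Bool := xor (xor (x 0 && x 1) (x 2 && x 3)) (x 0 && x 1 && x 2)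

/-- `g4W` is cubic. [cite: Carlet2020, §2.2.1 Def. 6] -/
theorem isDegLeFun_g4W : IsDegLeFun 3 g4W := by
  unfold g4W
  exact isDegLeFun_xor
    ((isDegLeFun_and (isDegLeFun_apply 0 (le_refl 1)) (isDegLeFun_apply 1 (le_refl 1))).mono (by norm_num))
    ((isDegLeFun_and (isDegLeFun_apply 2 (le_refl 1)) (isDegLeFun_apply 3 (le_refl 1))).mono (by norm_num))

/-- `f4W` is cubic. [cite: Carlet2020, §2.2.1 Def. 6] -/
theorem isDegLeFun_f4W : IsDegLeFun 3 f4W := by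
  unfold f4W
  exact isDegLeFun_xor (isDegLeFun_xor
    ((isDegLeFun_and (isDegLeFun_apply 0 (le_refl 1)) (isDegLeFun_apply 1 (le_refl 1))).mono (by norm_num))
    ((isDegLeFun_and (isDegLeFun_apply 2 (le_refl 1)) (isDegLeFun_apply 3 (le_refl 1))).mono (by norm_num)))
    ((isDegLeFun_and (isDegLeFun_and (isDegLeFun_apply 0 (le_refl 1)) (isDegLeFun_apply 1 (le_refl 1)))
      (isDegLeFun_apply 2 (le_refl 1))).mono (by norm_num))

/-- The kernel evaluation at `n = 4`: `Σ_k (−1)^{f4W(pt k)} · (wal (sigTable g4W))_k = 48`. [folklore] -/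
theorem val_f4W_g4W :
    ((List.range 16).map fun k => sgnZ (f4W (pt 4 k)) * ((wal 4 (sigTable 4 g4W))[k]?.getD 0)).sum = 48 := by
  decide

/-- **The witness value at `n = 4`**: `Φ(f4W, g4W) = 3/4` (`= 48/64`). [this work] -/
theorem forrelation_f4W_g4W : forrelation f4W g4W = 3 / 4 := by
  have h := ck_forrelation_mul_eq 2 f4W g4W
  have hsum : ∑ k ∈ range (2 ^ (2 + 2)), sgnZ (f4W (pt (2 + 2) k)) * wspec (2 + 2) g4W k = 48 := by
    rw [← val_f4W_g4W, ck_sum_map_range]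
    refine sum_congr rfl fun k hk => ?_
    rw [wal_sigTable 4 g4W k (mem_range.1 hk)]
  rw [hsum] at h
  norm_num at h
  linarith

/-- **`θ₄ = 3/4` exactly** (`IsLeast`): isolation holds at `3/4` on `4` bits and the pair `(f4W, g4W)` has `Φ = 3/4 ≠ 1`.
NOT summit progress. [this work] -/
theorem theta_four_isLeast :
    IsLeast {θ : ℝ | ∀ f g : (Fin 4 → Bool) → Bool, IsDegLeFun 3 f → IsDegLeFun 3 g →
      θ < forrelation f g → forrelation f g = 1} (3 / 4) := by
  refine ⟨fun f g hf hg h => isolation_four_34 f g hf hg h, fun θ hθ => ?_⟩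
  by_contra hlt
  have h1 := hθ f4W g4W isDegLeFun_f4W isDegLeFun_g4W (by rw [forrelation_f4W_g4W]; linarith)
  rw [forrelation_f4W_g4W] at h1
  norm_num at h1

/-! ### The row `n = 2`: `θ₂ = 1/2` (all `16 × 16` pairs, by evaluation) -/

/-- The integer forrelation sum on `2` bits, `Σ_k (−1)^{f(pt k)} W_g(k) = 8·Φ(f,g)`, as a list computation. -/
def l2sum (f g : (Fin 2 → Bool) → Bool) : ℤ :=
  ((List.range 4).map fun k => sgnZ (f (pt 2 k)) * ((wal 2 (sigTable 2 g))[k]?.getD 0)).sum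

/-- All `256` pairs on `2` bits: the sum is `8` or at most `4`. -/
theorem l2sum_all : ∀ f g : (Fin 2 → Bool) → Bool, l2sum f g = 8 ∨ l2sum f g ≤ 4 := by native_decide

/-- **Every pair of Boolean functions on `2` bits has `Φ = 1` or `Φ ≤ 1/2`** (on `2` bits every function is cubic). [this work] -/
theorem nearExact_top_two (f g : (Fin 2 → Bool) → Bool) : forrelation f g = 1 ∨ forrelation f g ≤ 1 / 2 := by
  have h := ck_forrelation_mul_eq 1 f g
  have hsum : ∑ k ∈ range (2 ^ (1 + 1)), sgnZ (f (pt (1 + 1) k)) * wspec (1 + 1) g k = l2sum f g := by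
    rw [l2sum, ck_sum_map_range]
    refine sum_congr rfl fun k hk => ?_
    rw [wal_sigTable 2 g k (mem_range.1 hk)]
  rw [hsum] at h
  norm_num at h
  rcases l2sum_all f g with h8 | h4
  · left; rw [h8] at h; push_cast at h; linarith
  · right
    have : ((l2sum f g : ℤ) : ℝ) ≤ 4 := by exact_mod_cast h4
    linarith

/-- The witness on `2` bits: `Φ(0, x₀x₁) = 1/2`. [this work] -/
theorem forrelation_two_witness : forrelation (fun _ : Fin 2 → Bool => false) (fun x : Fin 2 → Bool => x 0 && x 1) = 1 / 2 := by
  have h := ck_forrelation_mul_eq 1 (fun _ : Fin 2 → Bool => false) (fun x : Fin 2 → Bool => x 0 && x 1)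
  have hsum : ∑ k ∈ range (2 ^ (1 + 1)), sgnZ ((fun _ : Fin (1 + 1) → Bool => false) (pt (1 + 1) k)) *
      wspec (1 + 1) (fun x : Fin (1 + 1) → Bool => x 0 && x 1) k = 4 := by
    have e : ((List.range 4).map fun k => sgnZ ((fun _ : Fin 2 → Bool => false) (pt 2 k)) *
        ((wal 2 (sigTable 2 fun x : Fin 2 → Bool => x 0 && x 1))[k]?.getD 0)).sum = 4 := by decide
    rw [← e, ck_sum_map_range]
    refine sum_congr rfl fun k hk => ?_
    rw [wal_sigTable 2 _ k (mem_range.1 hk)]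
  rw [hsum] at h
  norm_num at h
  linarith

/-- **`θ₂ = 1/2` exactly** (`IsLeast`; the hypotheses `IsDegLeFun 3` are vacuous on `2` bits but kept for the uniform
shape of the ladder rows). NOT summit progress. [this work] -/
theorem theta_two_isLeast :
    IsLeast {θ : ℝ | ∀ f g : (Fin 2 → Bool) → Bool, IsDegLeFun 3 f → IsDegLeFun 3 g →
      θ < forrelation f g → forrelation f g = 1} (1 / 2) := by
  refine ⟨fun f g _ _ h => ?_, fun θ hθ => ?_⟩
  · rcases nearExact_top_two f g with h1 | h1
    · exact h1
    · linarith
  · by_contra hlt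
    have hf : IsDegLeFun 3 (fun _ : Fin 2 → Bool => false) := isDegLeFun_const 3 false
    have hg : IsDegLeFun 3 (fun x : Fin 2 → Bool => x 0 && x 1) :=
      (isDegLeFun_and (isDegLeFun_apply (0 : Fin 2) (le_refl 1)) (isDegLeFun_apply (1 : Fin 2) (le_refl 1))).mono
        (by norm_num)
    have h1 := hθ _ _ hf hg (by rw [forrelation_two_witness]; linarith)
    rw [forrelation_two_witness] at h1
    norm_num at h1

/-- **The decided small rows are strictly increasing**: `θ₂ = 1/2 < θ₄ = 3/4 < θ₆ = 25/32 < θ₈ = 13/16 < θ₁₀ = 7/8`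
(all even `n ≤ 10` are now decided). [this work] -/
theorem theta_small_rows_strictMono :
    (1 / 2 : ℝ) < 3 / 4 ∧ (3 / 4 : ℝ) < 25 / 32 ∧ (25 / 32 : ℝ) < 13 / 16 ∧ (13 / 16 : ℝ) < 7 / 8 := by
  norm_num

end Summit.QuantumAdvantage.QuantumAdvantage.Theorems.CubicForrelation.NearExactIsExact
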